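import Summits.HodgeConjecture.HodgeCM.CM.CommonReflexSpan_1

/-! PORT of `HodgeCM/CM/CommonReflexSpan.lean` (HodgeCMPerL run 81) — part 2: continuation of `Summits.HodgeConjecture.HodgeCM.CM.CommonReflexSpan_1` (split at a top-level declaration boundary by port_pkg.py; scope re-opened below; declarations unchanged). -/

-- port_pkg: scope re-opened for this part (file-level context, then the namespace/section stack open at the cut)
set_option autoImplicit false
noncomputable section
open scoped TensorProduct
open NumberField CategoryTheory Module
namespace HodgeCM.CM.CommonReflex
open Literature.AlgebraicGeometry.Motives (SchemeOver IsSmoothProjective CMType AbelianVariety bettiCohomology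
  ofRatClassBaseChange ComplexPoints)
open Literature.AlgebraicGeometry.HodgeTheory (complexBetti IsOfHodgeType HodgeModel ofRatClassBaseChangeEquiv
  hodgePQ_independent_of_hodgeModel IsHodgeMorphismOne DeligneMilne1982_Thm_6_20_full)
open Literature.AlgebraicGeometry.HodgeTheory.BettiUniverse (pull pull_comp cmAction IsInducedOnIntegers
  ofRatClassBaseChange_cmAction finrank_bettiCohomology_eq)
open Literature.AlgebraicGeometry.ComplexMultiplication
open Literature.NumberTheory.Automorphic.PicardCM (eigenline)
open Literature.NumberTheory.ComplexMultiplication (inducedCMType mem_inducedCMType_iff inducedCMType_id)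
section Realisation
variable {M' K M : Type} [Field M'] [NumberField M'] [Field K] [NumberField K] [Field M] [NumberField M]
  (k₁ : M' →+* K) (k₂ : M' →+* M) {Φ' : CMType M'}
  {C : AbelianVariety ℂ} {ιC : 𝓞 M' →+* End C} {θC : M' →+* Module.End ℂ (complexBetti C.X 1)}
  {B : AbelianVariety ℂ} {ιB : 𝓞 K →+* End B} {θB : K →+* Module.End ℂ (complexBetti B.X 1)}
  {A : AbelianVariety ℂ} {ιA : 𝓞 M →+* End A} {θA : M →+* Module.End ℂ (complexBetti A.X 1)}
/-- **(L2) The `τ`-eigenline of `ℂ ⊗ H¹(A; ℚ)` is swept by pull-backs of the `σ`-eigenline of `ℂ ⊗ H¹(B; ℚ)`** along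
morphisms `u : A → B` of the underlying varieties, whenever `τ ∘ k₂ = σ ∘ k₁` — for realisations `B` of `Φ'^K`, `A` of
`Φ'^M` and `C` of the base pair `(M', Φ')`, granted Riemann's fullness `hR` and the model-independence `hI`.
[folklore] -/
theorem eigenline_le_span_pull_eigenline (hR : DeligneMilne1982_Thm_6_20_full)
    (hI : hodgePQ_independent_of_hodgeModel)
    (hC : IsCMTypeRealisation Φ' C ιC θC)
    (hB : IsCMTypeRealisation (inducedCMType k₁ Φ') B ιB θB)
    (hA : IsCMTypeRealisation (inducedCMType k₂ Φ') A ιA θA)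
    (hθC : IsInducedOnIntegers θC) (hθB : IsInducedOnIntegers θB) (hθA : IsInducedOnIntegers θA)
    {σ : K →+* ℂ} {τ : M →+* ℂ} (hστ : τ.comp k₂ = σ.comp k₁) :
    eigenline (complexify (cmAction θA hθA)) τ ≤
      Submodule.span ℂ {x | ∃ (u : A.X ⟶ B.X) (β : ℂ ⊗[ℚ] bettiCohomology B.X 1),
        β ∈ eigenline (complexify (cmAction θB hθB)) σ ∧ x = (pull u 1).baseChange ℂ β} := by
  classical
  haveI := finite_bettiCohomology_of_realisation hC
  haveI := finite_bettiCohomology_of_realisation hB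
  haveI := finite_bettiCohomology_of_realisation hA
  -- (1) `p_j : A → C`, pull-backs jointly bijective and `M'`-equivariant (type inflation from Riemann, along `k₂`)
  obtain ⟨m, p, hbij, hcomm⟩ := thm3_rational_of_riemann (fun A B ψ _ hB' h₁ h₂ ↦ hR A B ψ hB' ⟨h₁, h₂⟩) hI k₂ Φ'
    hC hA hθC hθA
  -- (2) `λ_l : H¹(B; ℚ) → H¹(C; ℚ)` `M'`-linear, jointly injective; Hodge, hence `r_l^* = n_l • λ_l` for `r_l : C ⟶ B`
  have hVC : Module.finrank ℚ (bettiCohomology C.X 1) = Module.finrank ℚ M' := by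
    rw [finrank_bettiCohomology_eq hC.1 1, hC.2.1]
  obtain ⟨m', lam, hinj, hequiv⟩ := exists_cmLinear_family_injective (cmAction θC hθC)
    ((cmAction θB hθB).comp k₁.toRatAlgHom) hVC
  have hequiv' : ∀ (l : Fin m') (a : M') (v : bettiCohomology B.X 1),
      lam l (cmAction θB hθB (k₁ a) v) = cmAction θC hθC ((RingHom.id M') a) (lam l v) := fun l a v ↦ by
    simpa using hequiv l a v
  have hC' : IsCMTypeRealisation (inducedCMType (RingHom.id M') Φ') C ιC θC := by
    rw [inducedCMType_id]; exact hC
  have hfull := fun l : Fin m' ↦ hR C B (lam l) hB.nonempty_hodgeModel_dim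
    (commonReflex_isHodgeMorphismOne k₁ (RingHom.id M') hI hB hC' hθB hθC (lam l) (hequiv' l))
  choose r n hn hr using hfull
  -- (3) the complex picture
  obtain ⟨bA, hbA⟩ := exists_basis_mem_eigenline_complexify hA hθA
  obtain ⟨bC, hbC⟩ := exists_basis_mem_eigenline_complexify hC hθC
  let P : Fin m → (ℂ ⊗[ℚ] bettiCohomology C.X 1 →ₗ[ℂ] ℂ ⊗[ℚ] bettiCohomology A.X 1) :=
    fun j ↦ (pull (p j) 1).baseChange ℂ
  let Rl : Fin m' → (ℂ ⊗[ℚ] bettiCohomology B.X 1 →ₗ[ℂ] ℂ ⊗[ℚ] bettiCohomology C.X 1) :=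
    fun l ↦ (pull (r l).hom.hom.hom 1).baseChange ℂ
  have hP : ∀ (j : Fin m) (a : M') (c : ℂ ⊗[ℚ] bettiCohomology C.X 1),
      P j (complexify (cmAction θC hθC) a c) = complexify (cmAction θA hθA) (k₂ a) (P j c) :=
    fun j a c ↦ baseChange_complexify_apply (cmAction θC hθC) (cmAction θA hθA) (pull (p j) 1)
      (fun v ↦ LinearMap.congr_fun (hcomm j a) v) c
  have hPsurj : ∀ x : ℂ ⊗[ℚ] bettiCohomology A.X 1, ∃ γ : Fin m → ℂ ⊗[ℚ] bettiCohomology C.X 1,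
      x = ∑ j, P j (γ j) := fun x ↦ exists_eq_sum_baseChange_of_bijective (fun j ↦ pull (p j) 1) hbij x
  have hrl : ∀ (l : Fin m') (v : bettiCohomology B.X 1), pull (r l).hom.hom.hom 1 v = n l • lam l v :=
    fun l v ↦ hr l v
  have hRl : ∀ (l : Fin m') (a : M') (c : ℂ ⊗[ℚ] bettiCohomology B.X 1),
      Rl l (complexify (cmAction θB hθB) (k₁ a) c) = complexify (cmAction θC hθC) a (Rl l c) :=
    fun l a c ↦ baseChange_complexify_apply (cmAction θB hθB) (cmAction θC hθC) (pull (r l).hom.hom.hom 1)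
      (fun v ↦ by rw [hrl, hrl, map_nsmul, hequiv' l a v, RingHom.id_apply]) c
  have hRinj : ∀ c : ℂ ⊗[ℚ] bettiCohomology B.X 1, (∀ l, Rl l c = 0) → c = 0 := by
    intro c hc
    refine eq_zero_of_forall_baseChange_eq_zero lam hinj c fun l ↦ ?_
    have hnl : (pull (r l).hom.hom.hom 1) = (n l : ℚ) • lam l := by
      refine LinearMap.ext fun v ↦ ?_
      rw [hrl, LinearMap.smul_apply, Nat.cast_smul_eq_nsmul]
    have h0 := hc l
    simp only [Rl, hnl, LinearMap.baseChange_smul, LinearMap.smul_apply] at h0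
    exact (smul_eq_zero.1 h0).resolve_left (by exact_mod_cast (hn l).ne')
  -- a nonzero `σ`-eigenvector of `B`
  have hne : eigenline (complexify (cmAction θB hθB)) σ ≠ ⊥ := by
    intro hbot
    have h1 := finrank_eigenline_complexify_eq_one hB hθB σ
    rw [hbot, finrank_bot] at h1
    exact zero_ne_one h1
  obtain ⟨β, hβ, hβ0⟩ := Submodule.exists_mem_ne_zero_of_ne_bot hne
  -- conclude
  intro x hx
  obtain ⟨l, d, hxd⟩ := eigenline_mem_span_of_factorisation k₁ k₂ bA hbA bC hbC
    (finrank_eigenline_complexify_eq_one hC hθC) P hP hPsurj Rl hRl hRinj hβ hβ0 hστ hx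
  rw [hxd]
  refine Submodule.sum_mem _ fun j _ ↦ Submodule.smul_mem _ _ (Submodule.subset_span ?_)
  refine ⟨p j ≫ (r l).hom.hom.hom, β, hβ, ?_⟩
  simp only [P, Rl, pull_comp, LinearMap.baseChange_comp, LinearMap.comp_apply]

end Realisation

end HodgeCM.CM.CommonReflex

end
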